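import Summits.HodgeConjecture.CorCM.MumfordTateRankCMCurveTimesCMThreefold
import Literature.AlgebraicGeometry.Pohlmann1968.CMFamilyRankSubfamilies
import HarnessLib

/-!
# Monotonicity of the Mumford–Tate rank for CM products: `t(Y) ≤ t(X)` whenever `Y` is dominated by a CM abelian variety `X` — in particular for
# `X ∼ Y × Z` of CM type (the torus shadow of «`Hg(Y × Z) → Hg(Y)` is surjective», Moonen–Zarhin 1999 §3 (3.1); Gordon 9.1)

COR-CM (cell `pub-hodgecm2`, seat `b27` gen 50, count-neutral Mumford–Tate-rank ladder; theorems only, no definition, no named fact;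
UNCONDITIONAL — nothing here uses or asserts HC_CM).  Notation `t(X) = dim MT(H¹X)`.

On the ladder, `t(X₁ × X₂) ≥ t(X₁)` is proved for a `Θ`-RIGID factor `X₁` (`CorCM/MumfordTateRankRigidMonotone`: the restriction of `Lie Hg` to the
factor is onto).  Rigidity fails for CM factors in general (a simple CM threefold with cyclic sextic field has `Θ` on a rational plane of `Lie U_K`).
For CM products the substitute is the CM-type rank calculus: `t(X) = cmFamilyRank Φ` for `X ∼ ⨁_j A'_{cls j}` with CM realisations `A'_c`
(`mtRank_hodge_one_eq_cmFamilyRank_of_isIsogenous_biproduct`, Gordon 9.1), and the rank of a SUB-family is at most that of the family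
(`Pohlmann1968.cmFamilyRank_comp_le`: the span of the Galois translates of fewer type vectors is a projection of the span of all).  Milne's regrouping
of a CM variety `X` (`exists_isIsogeny_biproduct_of_isSimple_of_isOfCMType`) and of a dominated `Y` supplies the families: every simple factor of `Y` is
dominated by `X`, hence isogenous to one of the representatives `A'_c` (`exists_isIsogenous_of_isSimple_of_avDominatedBy_biproduct`), so
`Y ∼ ⨁_k A'_{c(k)}` for some reindexing `c`.

* **`mtRank_hodge_one_le_of_avDominatedBy_of_isOfCMType`** — `Y` of positive dimension dominated by a CM variety `X` ⟹ `t(Y) ≤ t(X)`;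
* **`mtRank_hodge_one_le_of_isIsogenous_prod_of_isOfCMType`** — `X ∼ Y × Z` of CM type ⟹ `t(Y) ≤ t(X)` (and `t(Z) ≤ t(X)`).

## References
* [MoonenZarhin1999LowDim] B. Moonen, Yu. G. Zarhin, *Hodge classes on abelian varieties of low dimension*, Math. Ann. 315 (1999), §3 (3.1)
  [corpus: paper:arxiv-math_9901113 p. 6]. [cite: MoonenZarhin1999LowDim, §3 (3.1)]
* [Gordon1999HodgeAVSurvey] B. B. Gordon, *A survey of the Hodge conjecture for abelian varieties*, 7.4–7.7, 9.1. [cite: Gordon1999HodgeAVSurvey, 7.7 and 9.1]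
* [MumfordAV1970] D. Mumford, *Abelian Varieties* (1970), §19 Thm. 1 and Cor. 1. [cite: MumfordAV1970, §19 Cor. 1 of Thm. 1]
-/

noncomputable section

open CategoryTheory CategoryTheory.Limits NumberField Module
open scoped BigOperators

namespace Summit.HodgeConjecture.CorCM

open Literature.NumberTheory.ComplexMultiplication
open Literature.AlgebraicGeometry.Motives
open Literature.AlgebraicGeometry.Motives.AbelianVariety
open Literature.AlgebraicGeometry.HodgeTheory
open Literature.AlgebraicGeometry.ComplexMultiplication
open Literature.AlgebraicGeometry.Milne1999 (IsOfCMType isOfCMType_iff_of_isIsogenous isIsogeny_biproduct_map isOfCMType_prod_iff)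
open Literature.AlgebraicGeometry.Pohlmann1968
open Summit.HodgeConjecture.CorCM.Domination

variable [HodgeTensorFacts.{0, 0}] {X Y Z : AbelianVariety ℂ} {n k : ℕ}

/-- **`t(Y) ≤ t(X)` for `Y` dominated by a CM abelian variety `X`** (`Y → X → Y` composing to `N ≠ 0`, both of positive dimension, `Y` of CM type —
automatic for a factor of `X` up to isogeny).  Milne's regroupings `X ∼ ⨁_j A'_{cls j}`, `Y ∼ ⨁_k B_{cls₂ k}` by simple CM realisations; each `B_{cls₂ k}` is dominated by `⨁_j A'_{cls j}`,
hence isogenous to some `A'_{c k}`; so `t(Y) = cmFamilyRank (Φ' ∘ c) ≤ cmFamilyRank Φ' = t(X)`. [cite: MoonenZarhin1999LowDim, §3 (3.1)]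
[cite: Gordon1999HodgeAVSurvey, 7.7 and 9.1] [cite: MumfordAV1970, §19 Cor. 1 of Thm. 1] -/
theorem mtRank_hodge_one_le_of_avDominatedBy_of_isOfCMType (hX : IsSmoothProjective n X.X) (hY : IsSmoothProjective k Y.X) (hX0 : 0 < X.dim)
    (hY0 : 0 < Y.dim) (hXcm : IsOfCMType X) (hYcm : IsOfCMType Y) (hdom : AVDominatedBy Y X) :
    haveI := BettiUniverse.finite hX 1
    haveI := BettiUniverse.finite hY 1
    (BettiUniverse.hodge exists_isReal_hodgeModel_holds hY 1).mtRank ≤ (BettiUniverse.hodge exists_isReal_hodgeModel_holds hX 1).mtRank := by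
  classical
  haveI := BettiUniverse.finite hX 1
  haveI := BettiUniverse.finite hY 1
  -- Milne's regrouping of `X` and of `Y`
  obtain ⟨C, _, K', _, _, _, Φ', A', ι', θ', m, cls, f, hA, hs, hniso, hcls, hf⟩ := exists_isIsogeny_biproduct_of_isSimple_of_isOfCMType hX0 hXcm
  obtain ⟨C₂, _, K₂, _, _, _, Ψ, B, ι₂, θ₂, m₂, cls₂, f₂, hB, hsB, -, -, hf₂⟩ := exists_isIsogeny_biproduct_of_isSimple_of_isOfCMType hY0 hYcm
  -- every `B (cls₂ k)` is dominated by `⨁_j A' (cls j)`, hence isogenous to some `A' c`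
  have hdimpos : ∀ c₂, 0 < (B c₂).dim := fun c₂ => by
    have h := finrank_eq_two_mul_dim_of_isCMTypeRealisation (hB c₂)
    have hpos : 0 < finrank ℚ (K₂ c₂) := Module.finrank_pos
    omega
  have hrep : ∀ k₂ : Fin (m₂ + 1), ∃ c, IsIsogenous (B (cls₂ k₂)) (A' c) := fun k₂ => by
    have hdomB : AVDominatedBy (B (cls₂ k₂)) (⨁ fun j => A' (cls j)) :=
      (((avDominatedBy_biproduct_summand (fun i => B (cls₂ i)) k₂).trans_isIsogeny_inv hf₂).trans hdom).trans_isIsogeny_hom hf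
    obtain ⟨j, hj⟩ := exists_isIsogenous_of_isSimple_of_avDominatedBy_biproduct (fun j => hs (cls j)) (hsB (cls₂ k₂)) (hdimpos _) hdomB
    exact ⟨cls j, hj⟩
  choose c hc using hrep
  -- `Y ∼ ⨁_k A' (c k)`
  choose g hg using hc
  have hYB : IsIsogenous Y (⨁ fun k₂ : Fin (m₂ + 1) => A' (id (c k₂))) :=
    IsIsogenous.trans ⟨f₂, hf₂⟩ ⟨biproduct.map g, isIsogeny_biproduct_map hg⟩
  -- the rank dictionary and the sub-family inequality
  rw [mtRank_hodge_one_eq_cmFamilyRank_of_isIsogenous_biproduct (A' := fun k₂ => A' (c k₂)) (cls := id) (Φ' := fun k₂ => Φ' (c k₂))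
      (fun k₂ => hA (c k₂)) Function.surjective_id hY hYB,
    mtRank_hodge_one_eq_cmFamilyRank_of_isIsogenous_biproduct hA hcls hX ⟨f, hf⟩]
  exact CMAlgebra.cmFamilyRank_comp_le Φ' c

/-- **`t(Y) ≤ t(X)` and `t(Z) ≤ t(X)` for `X ∼ Y × Z` of CM type** (`dim Y, dim Z > 0`): the Mumford–Tate rank of a CM product dominates that of each
factor — Moonen–Zarhin's «the projections `Hg(X₁ × X₂) → Hg(X_i)` are surjective» in rank form for tori. [cite: MoonenZarhin1999LowDim, §3 (3.1)]
[cite: Gordon1999HodgeAVSurvey, 7.7 and 9.1] -/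
theorem mtRank_hodge_one_le_of_isIsogenous_prod_of_isOfCMType (hX : IsSmoothProjective n X.X) (hY : IsSmoothProjective k Y.X) (hY0 : 0 < Y.dim)
    {k' : ℕ} (hZ : IsSmoothProjective k' Z.X) (hZ0 : 0 < Z.dim) (hXcm : IsOfCMType X) (hXP : IsIsogenous X (Y.prod Z)) :
    haveI := BettiUniverse.finite hX 1
    haveI := BettiUniverse.finite hY 1
    haveI := BettiUniverse.finite hZ 1
    (BettiUniverse.hodge exists_isReal_hodgeModel_holds hY 1).mtRank ≤ (BettiUniverse.hodge exists_isReal_hodgeModel_holds hX 1).mtRank ∧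
      (BettiUniverse.hodge exists_isReal_hodgeModel_holds hZ 1).mtRank ≤ (BettiUniverse.hodge exists_isReal_hodgeModel_holds hX 1).mtRank := by
  obtain ⟨g, hg⟩ := hXP
  have hX0 : 0 < X.dim := by rw [dim_eq_of_isIsogeny hg, dim_prod]; omega
  have hcm : IsOfCMType (Y.prod Z) := (isOfCMType_iff_of_isIsogenous ⟨g, hg⟩).1 hXcm
  obtain ⟨hYcm, hZcm⟩ := isOfCMType_prod_iff.1 hcm
  exact ⟨mtRank_hodge_one_le_of_avDominatedBy_of_isOfCMType hX hY hX0 hY0 hXcm hYcm ((SliceExhaustion.avDominatedBy_prod_left Y Z).trans_isIsogeny_inv hg),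
    mtRank_hodge_one_le_of_avDominatedBy_of_isOfCMType hX hZ hX0 hZ0 hXcm hZcm ((avDominatedBy_prod_right Y Z).trans_isIsogeny_inv hg)⟩

end Summit.HodgeConjecture.CorCM

end
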